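import Literature.Analysis.FluidPDE.TwoPointMaximumPrinciple
import HarnessLib

/-!
# The two-point comparison principle for drift–diffusion (Kružkov doubling / Andrews–Clutterbuck)

Topic `Literature/Analysis/FluidPDE` (family `ns`).  `TwoPoint.twoPoint_comparison`: for a bounded
classical solution of `∂ₜθ = Δθ − ⟪b, ∇θ⟫` on `[T₁,T₂] × E` with `‖b(t,·)‖ ≤ Λ(t)` (no other hypothesis
on the drift) and a barrier `φ(t,r)`, `φ_r ≥ 0`, with `φ_t ≥ 4φ_rr + 2Λ(t)φ_r` on `r > 0` and
`φ(T₁,·) ≥ 2 sup|θ|`:  `θ(t,x) − θ(t,y) ≤ φ(t,‖x−y‖)`.  Proof: `TwoPoint.weak_max_principle_localMax`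
on `B̄_L × B̄_L ⊂ E × E` for `θ(x) − θ(y) − φ(‖x−y‖) − (2M/L²)(‖x‖²+‖y‖²) − γ_L(t − T₁)` with the
two-point second-order test `TwoPoint.twoPoint_secondOrder`, then `L → ∞`.  Consumed by
`DriftDiffusionTypeIDriftBarrier` (THEOREM U of `pub/ns-exp-scalarLiouville/MAP.md` rev 2 §2).
WHAT THIS IS NOT: a statement about the LINEAR model `(SL)` `∂ₜθ + b·∇θ = Δθ` only; nothing here proves or refutes
`stub_scalarLiouville`, `PoloidalLiouville` (stmt-NavierStokesRegularity-1222) or Navier–Stokes regularity.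
References: [Lieberman1996] Ch. II; [Kruzkov1970]; Andrews–Clutterbuck, J. AMS 24 (2011) §2.
-/

noncomputable section

open Set Function Filter Metric Topology InnerProductSpace
open scoped RealInnerProductSpace Laplacian Topology

namespace Literature.Analysis.FluidPDE

namespace TwoPoint

/-! ### §3 The two-point comparison principle -/

section Comparison

variable {E : Type*} [NormedAddCommGroup E] [InnerProductSpace ℝ E] [FiniteDimensional ℝ E]

/-- `⟪b, ∇f(x)⟫ = Df(x) b`. [folklore] -/
private theorem inner_gradient_eq_fderiv (f : E → ℝ) (x b : E) :
    ⟪b, gradient f x⟫ = fderiv ℝ f x b := by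
  rw [real_inner_comm, inner_gradient_left]

omit [FiniteDimensional ℝ E] in
/-- A slice `θ t` of a function `C²` on an open time slab is `C²`. [folklore] -/
private theorem contDiff_slice {θ : ℝ → E → ℝ} {tlo thi : ℝ}
    (hθ : ContDiffOn ℝ 2 (uncurry θ) (Ioo tlo thi ×ˢ univ)) {t : ℝ} (ht : t ∈ Ioo tlo thi) :
    ContDiff ℝ 2 (θ t) := by
  have h1 : ContDiffOn ℝ 2 (fun z : E => (t, z)) univ := (contDiffOn_const.prodMk contDiffOn_id)
  have h2 := hθ.comp h1 (fun z _ => mk_mem_prod ht (mem_univ z))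
  exact contDiffOn_univ.1 h2

omit [FiniteDimensional ℝ E] in
/-- Time slices of a `C²` space–time function are differentiable in time. [folklore] -/
private theorem hasDerivAt_time_slice {θ : ℝ → E → ℝ} {tlo thi : ℝ}
    (hθ : ContDiffOn ℝ 2 (uncurry θ) (Ioo tlo thi ×ˢ univ)) {t : ℝ} (ht : t ∈ Ioo tlo thi) (x : E) :
    HasDerivAt (fun s => θ s x) (deriv (fun s => θ s x) t) t := by
  have hopen : IsOpen (Ioo tlo thi ×ˢ (univ : Set E)) := isOpen_Ioo.prod isOpen_univ
  have hd : DifferentiableAt ℝ (uncurry θ) (t, x) :=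
    (hθ.differentiableOn two_ne_zero).differentiableAt (hopen.mem_nhds (mk_mem_prod ht (mem_univ x)))
  have hl : DifferentiableAt ℝ (fun s : ℝ => (s, x)) t := by fun_prop
  have h := hd.comp t hl
  exact h.hasDerivAt

/-- **Two-point comparison principle** (Kružkov doubling of variables / Andrews–Clutterbuck modulus
of continuity, for drift–diffusion).  Let `θ` be `C²` on the slab `(t_lo, t_hi) × E`, bounded by
`M` and solving `∂ₜθ = Δθ − ⟪b, ∇θ⟫` on `[T₁, T₂] × E` with a drift bounded by `Λ(t) ≤ Λ̄`
(`Λ ≥ 0`; no other hypothesis on `b`).  Let `φ(t, r)` be continuous on `[T₁,T₂] × [0,∞)`,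
nonnegative, `C²` in `r > 0` with `φ_r ≥ 0`, differentiable in `t`, with
`φ_t ≥ 4φ_rr + 2Λ(t)φ_r` on `(T₁,T₂] × (0,∞)` and `φ(T₁, ·) ≥ 2M`.  Then
`θ(t,x) − θ(t,y) ≤ φ(t, ‖x − y‖)` on `[T₁,T₂]`.  Proof: the weak maximum principle on
`B̄_L × B̄_L ⊂ E × E` for `θ(x) − θ(y) − φ(‖x−y‖) − (2M/L²)(‖x‖²+‖y‖²) − γ_L(t − T₁)` with the
two-point second-order test `twoPoint_secondOrder`, then `L → ∞`.
[cite: Lieberman1996, Ch. II Lemma 2.1 and Lemma 2.3] -/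
theorem twoPoint_comparison {θ : ℝ → E → ℝ} {b : ℝ → E → E} {Λ : ℝ → ℝ}
    {φ φt φr φrr : ℝ → ℝ → ℝ} {tlo thi T₁ T₂ M Λbar : ℝ}
    (hlo : tlo < T₁) (hT : T₁ ≤ T₂) (hhi : T₂ < thi)
    (hθ : ContDiffOn ℝ 2 (uncurry θ) (Ioo tlo thi ×ˢ univ))
    (hM : ∀ t ∈ Icc T₁ T₂, ∀ x, |θ t x| ≤ M)
    (hΛ : ∀ t ∈ Icc T₁ T₂, 0 ≤ Λ t) (hΛbar : ∀ t ∈ Icc T₁ T₂, Λ t ≤ Λbar)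
    (hb : ∀ t ∈ Icc T₁ T₂, ∀ x, ‖b t x‖ ≤ Λ t)
    (heq : ∀ t ∈ Icc T₁ T₂, ∀ x,
      deriv (fun s => θ s x) t = (Δ (θ t)) x - ⟪b t x, gradient (θ t) x⟫)
    (hφc : ContinuousOn (uncurry φ) (Icc T₁ T₂ ×ˢ Ici 0))
    (hφ0 : ∀ t ∈ Icc T₁ T₂, ∀ r, 0 ≤ r → 0 ≤ φ t r)
    (hφr : ∀ t ∈ Icc T₁ T₂, ∀ r, 0 < r → HasDerivAt (φ t) (φr t r) r)
    (hφrr : ∀ t ∈ Icc T₁ T₂, ∀ r, 0 < r → HasDerivAt (φr t) (φrr t r) r)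
    (hφt : ∀ t ∈ Ioc T₁ T₂, ∀ r, 0 < r → HasDerivAt (fun s => φ s r) (φt t r) t)
    (hφr0 : ∀ t ∈ Icc T₁ T₂, ∀ r, 0 < r → 0 ≤ φr t r)
    (hineq : ∀ t ∈ Ioc T₁ T₂, ∀ r, 0 < r → 4 * φrr t r + 2 * Λ t * φr t r ≤ φt t r)
    (hinit : ∀ r, 0 ≤ r → 2 * M ≤ φ T₁ r) :
    ∀ t ∈ Icc T₁ T₂, ∀ x y, θ t x - θ t y ≤ φ t ‖x - y‖ := by
  intro t ht x y
  have hI : ∀ s ∈ Icc T₁ T₂, s ∈ Ioo tlo thi := fun s hs => ⟨lt_of_lt_of_le hlo hs.1, lt_of_le_of_lt hs.2 hhi⟩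
  have hT₁ : T₁ ∈ Icc T₁ T₂ := ⟨le_rfl, hT⟩
  have hM0 : 0 ≤ M := le_trans (abs_nonneg _) (hM T₁ hT₁ x)
  have hΛbar0 : 0 ≤ Λbar := le_trans (hΛ T₁ hT₁) (hΛbar T₁ hT₁)
  refine le_of_forall_pos_le_add fun ε hε => ?_
  ---------------------------------------------------------------- choice of the radius `L`
  set n : ℕ := Module.finrank ℝ E with hn
  set L₀ : ℝ := max (max ‖x‖ ‖y‖) 1 with hL₀
  have hL₀1 : 1 ≤ L₀ := le_max_right _ _
  have hxL₀ : ‖x‖ ≤ L₀ := le_trans (le_max_left _ _) (le_max_left _ _)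
  have hyL₀ : ‖y‖ ≤ L₀ := le_trans (le_max_right _ _) (le_max_left _ _)
  set Q : ℝ := 4 * M * L₀ ^ 2 + (8 * n * M + 8 * M * Λbar) * (T₂ - T₁) with hQ
  have hQ0 : 0 ≤ Q := by
    have : 0 ≤ T₂ - T₁ := by linarith
    positivity
  set L : ℝ := max L₀ (Q / ε + 1) with hL
  have hL1 : 1 ≤ L := le_trans hL₀1 (le_max_left _ _)
  have hL0 : 0 < L := lt_of_lt_of_le one_pos hL1
  have hxL : ‖x‖ ≤ L := le_trans hxL₀ (le_max_left _ _)
  have hyL : ‖y‖ ≤ L := le_trans hyL₀ (le_max_left _ _)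
  have hQL : Q / L ≤ ε := by
    rw [div_le_iff₀ hL0]
    have h1 : Q / ε + 1 ≤ L := le_max_right _ _
    have h2 : Q / ε * ε = Q := div_mul_cancel₀ Q hε.ne'
    nlinarith
  set κ : ℝ := 2 * M / L ^ 2 with hκ
  have hκ0 : 0 ≤ κ := by positivity
  have hκL : κ * L ^ 2 = 2 * M := by rw [hκ]; field_simp
  set γ : ℝ := 4 * n * κ + 4 * κ * L * Λbar with hγ
  have hγ0 : 0 ≤ γ := by positivity
  have hpen : κ * (‖x‖ ^ 2 + ‖y‖ ^ 2) + γ * (T₂ - T₁) ≤ ε := by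
    have hT0 : 0 ≤ T₂ - T₁ := by linarith
    -- everything is `≤ (its numerator)/L`
    have h1 : κ * (‖x‖ ^ 2 + ‖y‖ ^ 2) ≤ 4 * M * L₀ ^ 2 / L := by
      have ha : ‖x‖ ^ 2 + ‖y‖ ^ 2 ≤ 2 * L₀ ^ 2 := by nlinarith [norm_nonneg x, norm_nonneg y]
      have hb : κ * (‖x‖ ^ 2 + ‖y‖ ^ 2) ≤ κ * (2 * L₀ ^ 2) := mul_le_mul_of_nonneg_left ha hκ0
      have hc : κ * (2 * L₀ ^ 2) = (4 * M * L₀ ^ 2 / L) * (1 / L) := by rw [hκ]; field_simp; ring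
      have hd : (4 * M * L₀ ^ 2 / L) * (1 / L) ≤ (4 * M * L₀ ^ 2 / L) * 1 := by
        apply mul_le_mul_of_nonneg_left _ (by positivity)
        rw [div_le_one hL0]; exact hL1
      linarith
    have h2 : γ * (T₂ - T₁) ≤ (8 * n * M + 8 * M * Λbar) * (T₂ - T₁) / L := by
      have ha : γ ≤ (8 * n * M + 8 * M * Λbar) / L := by
        have e1 : (4 : ℝ) * n * κ = (8 * n * M / L) * (1 / L) := by rw [hκ]; field_simp; ring
        have e2 : 4 * κ * L * Λbar = 8 * M * Λbar / L := by rw [hκ]; field_simp; ring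
        have e3 : (8 * n * M / L) * (1 / L) ≤ (8 * n * M / L) * 1 :=
          mul_le_mul_of_nonneg_left (by rw [div_le_one hL0]; exact hL1) (by positivity)
        rw [hγ, e1, e2, add_div]
        linarith
      have := mul_le_mul_of_nonneg_right ha hT0
      rwa [div_mul_eq_mul_div] at this
    have h3 : 4 * M * L₀ ^ 2 / L + (8 * n * M + 8 * M * Λbar) * (T₂ - T₁) / L = Q / L := by
      rw [hQ, add_div]
    linarith
  ---------------------------------------------------------------- the doubled function
  set W : ℝ → E × E → ℝ := fun s q =>
    θ s q.1 - θ s q.2 - φ s ‖q.1 - q.2‖ - κ * (‖q.1‖ ^ 2 + ‖q.2‖ ^ 2) - γ * (s - T₁) with hWdef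
  set Wt : ℝ → E × E → ℝ := fun s q =>
    deriv (fun σ => θ σ q.1) s - deriv (fun σ => θ σ q.2) s - φt s ‖q.1 - q.2‖ - γ with hWtdef
  set K : Set (E × E) := closedBall (0 : E) L ×ˢ closedBall (0 : E) L with hKdef
  set U : Set (E × E) := (ball (0 : E) L ×ˢ ball (0 : E) L) ∩ {q | q.1 ≠ q.2} with hUdef
  have hK : IsCompact K := (isCompact_closedBall _ _).prod (isCompact_closedBall _ _)
  have hU : IsOpen U := (isOpen_ball.prod isOpen_ball).inter (isOpen_ne_fun continuous_fst continuous_snd)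
  have hUK : U ⊆ K := fun q hq => ⟨ball_subset_closedBall hq.1.1, ball_subset_closedBall hq.1.2⟩
  ---------------------------------------------------------------- (hc) continuity
  have hc : ContinuousOn (uncurry W) (Icc T₁ T₂ ×ˢ K) := by
    have hθc := hθ.continuousOn
    have hθ1 : ContinuousOn (fun p : ℝ × (E × E) => θ p.1 p.2.1) (Icc T₁ T₂ ×ˢ K) := by
      have hm : ContinuousOn (fun p : ℝ × (E × E) => (p.1, p.2.1)) (Icc T₁ T₂ ×ˢ K) := by fun_prop
      exact hθc.comp hm fun p hp => mk_mem_prod (hI p.1 hp.1) (mem_univ _)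
    have hθ2 : ContinuousOn (fun p : ℝ × (E × E) => θ p.1 p.2.2) (Icc T₁ T₂ ×ˢ K) := by
      have hm : ContinuousOn (fun p : ℝ × (E × E) => (p.1, p.2.2)) (Icc T₁ T₂ ×ˢ K) := by fun_prop
      exact hθc.comp hm fun p hp => mk_mem_prod (hI p.1 hp.1) (mem_univ _)
    have hφ1 : ContinuousOn (fun p : ℝ × (E × E) => φ p.1 ‖p.2.1 - p.2.2‖) (Icc T₁ T₂ ×ˢ K) := by
      have hm : ContinuousOn (fun p : ℝ × (E × E) => (p.1, ‖p.2.1 - p.2.2‖)) (Icc T₁ T₂ ×ˢ K) := by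
        fun_prop
      exact hφc.comp hm fun p hp => mk_mem_prod hp.1 (norm_nonneg _)
    have hrest : Continuous (fun p : ℝ × (E × E) =>
        κ * (‖p.2.1‖ ^ 2 + ‖p.2.2‖ ^ 2) + γ * (p.1 - T₁)) := by fun_prop
    have hall : ContinuousOn (fun p : ℝ × (E × E) => θ p.1 p.2.1 - θ p.1 p.2.2 - φ p.1 ‖p.2.1 - p.2.2‖
        - (κ * (‖p.2.1‖ ^ 2 + ‖p.2.2‖ ^ 2) + γ * (p.1 - T₁))) (Icc T₁ T₂ ×ˢ K) :=
      ((hθ1.sub hθ2).sub hφ1).sub hrest.continuousOn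
    refine hall.congr fun p _ => ?_
    simp only [uncurry, hWdef]
    ring
  ---------------------------------------------------------------- (ht) time derivative
  have ht' : ∀ s ∈ Ioc T₁ T₂, ∀ q ∈ U, HasDerivWithinAt (fun σ => W σ q) (Wt s q) (Icc T₁ s) s := by
    intro s hs q hq
    have hsI : s ∈ Ioo tlo thi := hI s (Ioc_subset_Icc_self hs)
    have hr0 : 0 < ‖q.1 - q.2‖ := norm_pos_iff.2 (sub_ne_zero.2 hq.2)
    have h1 := hasDerivAt_time_slice hθ hsI q.1
    have h2 := hasDerivAt_time_slice hθ hsI q.2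
    have h3 := hφt s hs ‖q.1 - q.2‖ hr0
    have h4 : HasDerivAt (fun σ : ℝ => κ * (‖q.1‖ ^ 2 + ‖q.2‖ ^ 2) + γ * (σ - T₁)) γ s := by
      simpa using (((hasDerivAt_id s).sub_const T₁).const_mul γ).const_add (κ * (‖q.1‖ ^ 2 + ‖q.2‖ ^ 2))
    have h6 : HasDerivAt (fun σ => θ σ q.1 - θ σ q.2 - φ σ ‖q.1 - q.2‖
        - (κ * (‖q.1‖ ^ 2 + ‖q.2‖ ^ 2) + γ * (σ - T₁)))
        (deriv (fun σ => θ σ q.1) s - deriv (fun σ => θ σ q.2) s - φt s ‖q.1 - q.2‖ - γ) s :=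
      ((h1.sub h2).sub h3).sub h4
    have h5 : HasDerivAt (fun σ => W σ q) (Wt s q) s := by
      refine (h6.congr_of_eventuallyEq ?_).congr_deriv ?_
      · exact Filter.Eventually.of_forall fun σ => by simp only [hWdef]; ring
      · simp only [hWtdef]
    exact h5.hasDerivWithinAt
  ---------------------------------------------------------------- (hsub) the two-point test
  have hsub : ∀ s ∈ Ioc T₁ T₂, ∀ q ∈ U, IsLocalMax (W s) q → Wt s q ≤ 0 := by
    intro s hs q hq hmax
    have hs' : s ∈ Icc T₁ T₂ := Ioc_subset_Icc_self hs
    have hsI : s ∈ Ioo tlo thi := hI s hs'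
    obtain ⟨⟨hq1, hq2⟩, hq12⟩ := hq
    set x' : E := q.1 with hx'
    set y' : E := q.2 with hy'
    have hxy : x' ≠ y' := hq12
    set r : ℝ := ‖x' - y'‖ with hr
    have hr0 : 0 < r := norm_pos_iff.2 (sub_ne_zero.2 hxy)
    have hx'L : ‖x'‖ ≤ L := le_of_lt (mem_ball_zero_iff.1 hq1)
    have hy'L : ‖y'‖ ≤ L := le_of_lt (mem_ball_zero_iff.1 hq2)
    have hf : ContDiff ℝ 2 (θ s) := contDiff_slice hθ hsI
    have hg : ∀ᶠ ρ in 𝓝 r, HasDerivAt (φ s) (φr s ρ) ρ :=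
      (lt_mem_nhds hr0).mono fun ρ hρ => hφr s hs' ρ hρ
    have hg2 : HasDerivAt (φr s) (φrr s r) r := hφrr s hs' r hr0
    have hmax' : IsLocalMax (fun p : E × E => θ s p.1 - θ s p.2 - φ s ‖p.1 - p.2‖
        - κ * (‖p.1‖ ^ 2 + ‖p.2‖ ^ 2) - γ * (s - T₁)) (x', y') := by
      have hq' : q = (x', y') := by rw [hx', hy']
      rw [← hq']
      exact hmax
    obtain ⟨hA, hB, hLap⟩ := twoPoint_secondOrder hf hxy hg hg2 hmax'
    -- the time derivatives through the equation
    have hex := heq s hs' x'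
    have hey := heq s hs' y'
    rw [inner_gradient_eq_fderiv, hA] at hex
    rw [inner_gradient_eq_fderiv, hB] at hey
    -- bounds on the drift terms
    have hbx : ‖b s x'‖ ≤ Λ s := hb s hs' x'
    have hby : ‖b s y'‖ ≤ Λ s := hb s hs' y'
    have hΛs : Λ s ≤ Λbar := hΛbar s hs'
    have hφr' : 0 ≤ φr s r := hφr0 s hs' r hr0
    have hΛ0 : 0 ≤ Λ s := hΛ s hs'
    have i1 : -(Λ s) ≤ ⟪x' - y', b s x'⟫ / r := by
      rw [le_div_iff₀ hr0]
      have h1 := (abs_le.1 (abs_real_inner_le_norm (x' - y') (b s x'))).1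
      have h2 : r * ‖b s x'‖ ≤ r * Λ s := mul_le_mul_of_nonneg_left hbx hr0.le
      linarith
    have i2 : ⟪x' - y', b s y'⟫ / r ≤ Λ s := by
      rw [div_le_iff₀ hr0]
      have h1 := (abs_le.1 (abs_real_inner_le_norm (x' - y') (b s y'))).2
      have h2 : r * ‖b s y'‖ ≤ r * Λ s := mul_le_mul_of_nonneg_left hby hr0.le
      linarith
    have j1 : -(L * Λbar) ≤ ⟪x', b s x'⟫ := by
      have h1 := (abs_le.1 (abs_real_inner_le_norm x' (b s x'))).1
      have h2 : ‖x'‖ * ‖b s x'‖ ≤ L * Λbar :=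
        mul_le_mul hx'L (hbx.trans hΛs) (norm_nonneg _) hL0.le
      linarith
    have j2 : -(L * Λbar) ≤ ⟪y', b s y'⟫ := by
      have h1 := (abs_le.1 (abs_real_inner_le_norm y' (b s y'))).1
      have h2 : ‖y'‖ * ‖b s y'‖ ≤ L * Λbar :=
        mul_le_mul hy'L (hby.trans hΛs) (norm_nonneg _) hL0.le
      linarith
    have k1 : φr s r * -(Λ s) ≤ φr s r * (⟪x' - y', b s x'⟫ / r) :=
      mul_le_mul_of_nonneg_left i1 hφr'
    have k2 : φr s r * (⟪x' - y', b s y'⟫ / r) ≤ φr s r * Λ s :=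
      mul_le_mul_of_nonneg_left i2 hφr'
    have k3 : 2 * κ * -(L * Λbar) ≤ 2 * κ * ⟪x', b s x'⟫ :=
      mul_le_mul_of_nonneg_left j1 (by positivity)
    have k4 : 2 * κ * -(L * Λbar) ≤ 2 * κ * ⟪y', b s y'⟫ :=
      mul_le_mul_of_nonneg_left j2 (by positivity)
    have hin := hineq s hs r hr0
    have hγ' : γ = 4 * n * κ + 4 * κ * L * Λbar := rfl
    change deriv (fun σ => θ σ x') s - deriv (fun σ => θ σ y') s - φt s r - γ ≤ 0
    rw [hex, hey, hγ']
    linarith [hLap, hin, k1, k2, k3, k4]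
  ---------------------------------------------------------------- (hbot) initial time
  have hbot : ∀ q ∈ K, W T₁ q ≤ 0 := by
    intro q _
    have h1 := abs_le.1 (hM T₁ hT₁ q.1)
    have h2 := abs_le.1 (hM T₁ hT₁ q.2)
    have h3 := hinit ‖q.1 - q.2‖ (norm_nonneg _)
    have h4 : 0 ≤ κ * (‖q.1‖ ^ 2 + ‖q.2‖ ^ 2) := by positivity
    change θ T₁ q.1 - θ T₁ q.2 - φ T₁ ‖q.1 - q.2‖ - κ * (‖q.1‖ ^ 2 + ‖q.2‖ ^ 2) - γ * (T₁ - T₁) ≤ 0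
    rw [sub_self, mul_zero, sub_zero]
    linarith only [h1.2, h2.1, h3, h4]
  ---------------------------------------------------------------- (hlat) lateral boundary and diagonal
  have hlat : ∀ s ∈ Icc T₁ T₂, ∀ q ∈ K \ U, W s q ≤ 0 := by
    intro s hs q hq
    obtain ⟨hqK, hqU⟩ := hq
    have h1 := abs_le.1 (hM s hs q.1)
    have h2 := abs_le.1 (hM s hs q.2)
    have h3 := hφ0 s hs ‖q.1 - q.2‖ (norm_nonneg _)
    have h4 : 0 ≤ γ * (s - T₁) := mul_nonneg hγ0 (by linarith [hs.1])
    have hq1 : ‖q.1‖ ≤ L := mem_closedBall_zero_iff.1 hqK.1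
    have hq2 : ‖q.2‖ ≤ L := mem_closedBall_zero_iff.1 hqK.2
    change θ s q.1 - θ s q.2 - φ s ‖q.1 - q.2‖ - κ * (‖q.1‖ ^ 2 + ‖q.2‖ ^ 2) - γ * (s - T₁) ≤ 0
    -- either a norm equals `L`, or the point is diagonal
    by_cases hd : q.1 = q.2
    · have h5 : θ s q.1 - θ s q.2 = 0 := by rw [hd, sub_self]
      have h6 : 0 ≤ κ * (‖q.1‖ ^ 2 + ‖q.2‖ ^ 2) := by positivity
      linarith only [h5, h6, h3, h4]
    · have hnot : ¬ (‖q.1‖ < L ∧ ‖q.2‖ < L) := by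
        intro h
        exact hqU ⟨⟨mem_ball_zero_iff.2 h.1, mem_ball_zero_iff.2 h.2⟩, hd⟩
      have hsq : L ^ 2 ≤ ‖q.1‖ ^ 2 + ‖q.2‖ ^ 2 := by
        rcases not_and_or.1 hnot with h | h
        · have hL' : ‖q.1‖ = L := le_antisymm hq1 (not_lt.1 h)
          rw [← hL']
          linarith only [sq_nonneg ‖q.2‖]
        · have hL' : ‖q.2‖ = L := le_antisymm hq2 (not_lt.1 h)
          rw [← hL']
          linarith only [sq_nonneg ‖q.1‖]
      have hbig : κ * L ^ 2 ≤ κ * (‖q.1‖ ^ 2 + ‖q.2‖ ^ 2) := mul_le_mul_of_nonneg_left hsq hκ0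
      rw [hκL] at hbig
      linarith only [hbig, h1.2, h2.1, h3, h4]
  ---------------------------------------------------------------- conclusion
  have hxyK : (x, y) ∈ K := ⟨mem_closedBall_zero_iff.2 hxL, mem_closedBall_zero_iff.2 hyL⟩
  have main := weak_max_principle_localMax hK hU hUK hc ht' hsub hbot hlat t ht (x, y) hxyK
  change θ t x - θ t y - φ t ‖x - y‖ - κ * (‖x‖ ^ 2 + ‖y‖ ^ 2) - γ * (t - T₁) ≤ 0 at main
  have h5 : γ * (t - T₁) ≤ γ * (T₂ - T₁) := mul_le_mul_of_nonneg_left (by linarith only [ht.2]) hγ0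
  linarith only [main, h5, hpen]

end Comparison

end TwoPoint

end Literature.Analysis.FluidPDE

end
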